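import Literature.AlgebraicGeometry.Deformation.SmoothSchemeLiftObstructionCoverIndependence
import Literature.AlgebraicGeometry.Deformation.FlatDeformationTwoChartSystems
import Literature.AlgebraicGeometry.Deformation.FlatDeformationChartRefine
import HarnessLib

/-!
# The change-of-atlas intertwiners on a common refinement, and cover independence of the obstruction class of a flat
# deformation from its chart data (Hartshorne, *Deformation Theory*, proof of Thm. 10.2 (a): «independent of all choices»)

Layer `Literature/AlgebraicGeometry/Deformation`, namespace `Literature.AlgebraicGeometry.Deformation` (THEOREMS only: no
definition, no instance, no notation, no named fact).  ★ `SmoothSchemeLiftObstructionCoverIndependence` proves that the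
obstruction cochains `o`, `o₂` of one deformation datum on two principal affine covers agree on a common basic-open refinement
`𝔚` up to a Čech coboundary, GIVEN the restricted lift systems `ψ^W`, `ψ₂^W` and «change-of-atlas intertwiners» `F s` on
`𝔚` («★-to-be `SmoothSchemeLiftChartIntertwiners`; here hypotheses»).  THIS FILE SUPPLIES THEM from the chart data of an
actual flat deformation `Y` of the smooth `X` over `Ā = A ⧸ J` (`π' : Ā → k`, `J² = 0`; ★ c2b
`FlatDeformationTransitionData{,Cover}`: principal affine covers `U'`, `U″` of `Y`, their preimages `U`, `U₂`, chart
trivialisations `(e, ε₁, ε₂)`, `(e″, ε″₁, ε″₂)` over the closed fibres with transition data `≡ 1 (mod ker π')`; ★ GAP-1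
`SmoothSchemeLiftTransitionDataLift`: `A`-lifts `ψ`, `ψ″`), on a common principal affine refinement `V` by basic opens on
both sides (★ `Morphisms/PrincipalAffineCoverBasicOpenRefinement`):

* **`exists_chartIntertwiners`** — `∃ ψV ψ₂V F` with exactly the six hypothesis clauses of ★
  `exists_cechMD1_eq_refineC2_sub_refineC2` (`hψW hψW𝔫 hψ₂W hψ₂W𝔫 hF hFψ`): the restricted lifts (★
  `exists_algEquiv_refine`), the opens of `Y` above `V` (★ `exists_preimage_eq`), the restricted charts of both systems
  with `σ̂ ∘ ψV = transition ∘ σ̂` (★ `exists_charts_refine`), and the intertwiners of the two restricted chart systems (★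
  `exists_chartAut_of_two_chart_systems`);
* **`exists_cechMD1_eq_refineC2_sub_refineC2_of_charts`** — hence, for obstruction cochains `o`, `o″` of `ψ`, `ψ″` (★ F2's
  characterisation, coefficient line `e : J ≅ k`, `J · mk_J⁻¹ ker π' = 0`): `ρ_{τ₂} o″ − ρ_τ o = d¹α` on `V`, with NO
  refinement-level datum among the hypotheses;
* **`CechMH2.mk_refineC2_mapC2_eq_of_two_covers_of_charts`** — and `[ρ_{τ₂}(φ o″)] = [ρ_τ(φ o)]` in `Ȟ²(𝔙, N)` for every
  `φ : 𝒯_{X/k} ⟶ N` (★ `CechMH2.mk_refineC2_mapC2_eq_of_two_covers`).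

Cell `hodgecm-mathlib`, F-11 road (a′), slot (4) rel₂ of the (iv-5) assembly, applied with `U″ = [2]⁻¹U'` and `φ = π_a`.
HC_CM is proved only modulo the 7 printed citations until rung 0 closes — nothing here bears on a summit statement.

## References
* [Hartshorne2010] R. Hartshorne, *Deformation Theory*, GTM 257, Springer (2010): Thm. 10.2 (a) and its proof (p. 81),
  Cor. 10.3 (p. 82), Cor. 4.8 (pp. 32–33).
* [GortzWedhorn2023] U. Görtz, T. Wedhorn, *Algebraic Geometry II*, Springer Spektrum (2023): (21.16) Lemma 21.72 (p. 262).
-/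

noncomputable section

-- `TopCat.Presheaf`/`TopCat.Sheaf` are not reducible (as in Mathlib's `AlgebraicGeometry/Modules`).
set_option backward.isDefEq.respectTransparency false

open CategoryTheory AlgebraicGeometry Opposite TopologicalSpace Limits
open scoped TensorProduct

universe u

namespace Literature.AlgebraicGeometry.Deformation

open Literature.AlgebraicGeometry.HodgeTheory Literature.AlgebraicGeometry.Modules
  Literature.AlgebraicGeometry.Motives Literature.AlgebraicGeometry.Morphisms SmoothAffineDeformation

variable {k : Type u} [Field k] {A : Type u} [CommRing A] [Algebra k A] {J : Ideal A} (π' : (A ⧸ J) →ₐ[k] k)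
  {X : Over (Spec (CommRingCat.of k))} [instΓ : ∀ W : X.left.Opens, Algebra k Γ(X.left, W)]
  (halg : ∀ (W : X.left.Opens) (s : k), algebraMap k Γ(X.left, W) s = (constToPresheaf X).app (op W) s)
  {Y : Over (Spec (CommRingCat.of (A ⧸ J)))} [instΓA : ∀ W : Y.left.Opens, Algebra (A ⧸ J) Γ(Y.left, W)]
  (halgA : ∀ (W : Y.left.Opens) (a : A ⧸ J), algebraMap (A ⧸ J) Γ(Y.left, W) a = (constToPresheaf Y).app (op W) a)
  (i : X.left ⟶ Y.left) (hi : IsPullback i X.hom Y.hom (Spec.map (CommRingCat.ofHom π'.toRingHom)))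
  (hJ : J * J = ⊥) (h𝔫π : IsNilpotent (RingHom.ker π')) (h𝔫 : IsNilpotent ((RingHom.ker π').comap (Ideal.Quotient.mk J)))
  -- the first set of choices: cover, charts, transition data, lifts
  {ι : Type u} (U' : ι → Y.left.affineOpens) (b' : (j l : ι) → Γ(Y.left, (U' j).1))
  (hb' : ∀ j l, (U' j).1 ⊓ (U' l).1 = Y.left.basicOpen (b' j l))
  (U : ι → X.left.affineOpens) (hU : ∀ j, (U j).1 = i ⁻¹ᵁ (U' j).1)
  (b : (j l : ι) → Γ(X.left, (U j).1)) (hb : ∀ j l, (U j).1 ⊓ (U l).1 = X.left.basicOpen (b j l))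
  (e : ∀ j, (A ⧸ J) ⊗[k] Γ(X.left, (U j).1) ≃ₐ[A ⧸ J] Γ(Y.left, (U' j).1))
  (he : ∀ j x, i.appLE (U' j).1 (U j).1 (hU j).le (e j x) = specialFibreHom π' _ x)
  (ε₁ ε₂ : ∀ j l, (A ⧸ J) ⊗[k] Γ(X.left, (U j).1 ⊓ (U l).1) ≃ₐ[A ⧸ J] Γ(Y.left, (U' j).1 ⊓ (U' l).1))
  (hε₁ : ∀ j l (a : A ⧸ J) (s : Γ(X.left, (U j).1)),
    ε₁ j l (a ⊗ₜ X.left.presheaf.map (homOfLE inf_le_left).op s) =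
      Y.left.presheaf.map (homOfLE inf_le_left).op (e j (a ⊗ₜ s)))
  (hε₂ : ∀ j l (a : A ⧸ J) (s : Γ(X.left, (U l).1)),
    ε₂ j l (a ⊗ₜ X.left.presheaf.map (homOfLE inf_le_right).op s) =
      Y.left.presheaf.map (homOfLE inf_le_right).op (e l (a ⊗ₜ s)))
  (hφ : ∀ j l x, transition (ε₁ j l) (ε₂ j l) x - x ∈
    (RingHom.ker π') • (⊤ : Submodule (A ⧸ J) ((A ⧸ J) ⊗[k] Γ(X.left, (U j).1 ⊓ (U l).1))))
  (ψ : ∀ j l, A ⊗[k] Γ(X.left, (U j).1 ⊓ (U l).1) ≃ₐ[A] A ⊗[k] Γ(X.left, (U j).1 ⊓ (U l).1))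
  (hL : ∀ j l x, Algebra.TensorProduct.map (Ideal.Quotient.mkₐ k J) (AlgHom.id k Γ(X.left, (U j).1 ⊓ (U l).1)) (ψ j l x) =
    transition (ε₁ j l) (ε₂ j l)
      (Algebra.TensorProduct.map (Ideal.Quotient.mkₐ k J) (AlgHom.id k Γ(X.left, (U j).1 ⊓ (U l).1)) x))
  (hψ : ∀ j l x, ψ j l x - x ∈
    ((RingHom.ker π').comap (Ideal.Quotient.mk J)) • (⊤ : Submodule A (A ⊗[k] Γ(X.left, (U j).1 ⊓ (U l).1))))
  -- the second set of choices
  {ι' : Type u} (U'' : ι' → Y.left.affineOpens) (b'' : (j l : ι') → Γ(Y.left, (U'' j).1))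
  (hb'' : ∀ j l, (U'' j).1 ⊓ (U'' l).1 = Y.left.basicOpen (b'' j l))
  (U₂ : ι' → X.left.affineOpens) (hU₂ : ∀ j, (U₂ j).1 = i ⁻¹ᵁ (U'' j).1)
  (b₂ : (j l : ι') → Γ(X.left, (U₂ j).1)) (hb₂ : ∀ j l, (U₂ j).1 ⊓ (U₂ l).1 = X.left.basicOpen (b₂ j l))
  (e'' : ∀ j, (A ⧸ J) ⊗[k] Γ(X.left, (U₂ j).1) ≃ₐ[A ⧸ J] Γ(Y.left, (U'' j).1))
  (he'' : ∀ j x, i.appLE (U'' j).1 (U₂ j).1 (hU₂ j).le (e'' j x) = specialFibreHom π' _ x)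
  (ε''₁ ε''₂ : ∀ j l, (A ⧸ J) ⊗[k] Γ(X.left, (U₂ j).1 ⊓ (U₂ l).1) ≃ₐ[A ⧸ J] Γ(Y.left, (U'' j).1 ⊓ (U'' l).1))
  (hε''₁ : ∀ j l (a : A ⧸ J) (s : Γ(X.left, (U₂ j).1)),
    ε''₁ j l (a ⊗ₜ X.left.presheaf.map (homOfLE inf_le_left).op s) =
      Y.left.presheaf.map (homOfLE inf_le_left).op (e'' j (a ⊗ₜ s)))
  (hε''₂ : ∀ j l (a : A ⧸ J) (s : Γ(X.left, (U₂ l).1)),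
    ε''₂ j l (a ⊗ₜ X.left.presheaf.map (homOfLE inf_le_right).op s) =
      Y.left.presheaf.map (homOfLE inf_le_right).op (e'' l (a ⊗ₜ s)))
  (hφ'' : ∀ j l x, transition (ε''₁ j l) (ε''₂ j l) x - x ∈
    (RingHom.ker π') • (⊤ : Submodule (A ⧸ J) ((A ⧸ J) ⊗[k] Γ(X.left, (U₂ j).1 ⊓ (U₂ l).1))))
  (ψ'' : ∀ j l, A ⊗[k] Γ(X.left, (U₂ j).1 ⊓ (U₂ l).1) ≃ₐ[A] A ⊗[k] Γ(X.left, (U₂ j).1 ⊓ (U₂ l).1))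
  (hL'' : ∀ j l x,
    Algebra.TensorProduct.map (Ideal.Quotient.mkₐ k J) (AlgHom.id k Γ(X.left, (U₂ j).1 ⊓ (U₂ l).1)) (ψ'' j l x) =
    transition (ε''₁ j l) (ε''₂ j l)
      (Algebra.TensorProduct.map (Ideal.Quotient.mkₐ k J) (AlgHom.id k Γ(X.left, (U₂ j).1 ⊓ (U₂ l).1)) x))
  (hψ'' : ∀ j l x, ψ'' j l x - x ∈
    ((RingHom.ker π').comap (Ideal.Quotient.mk J)) • (⊤ : Submodule A (A ⊗[k] Γ(X.left, (U₂ j).1 ⊓ (U₂ l).1))))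
  -- the common principal affine refinement by basic opens on both sides
  {κ : Type u} (V : κ → X.left.affineOpens) (c : (s t : κ) → Γ(X.left, (V s).1))
  (hc : ∀ s t, (V s).1 ⊓ (V t).1 = X.left.basicOpen (c s t))
  (τ : κ → ι) (hτ : ∀ s, (V s).1 ≤ (U (τ s)).1) (a : (s : κ) → Γ(X.left, (U (τ s)).1))
  (hVa : ∀ s, (V s).1 = X.left.basicOpen (a s))
  (τ₂ : κ → ι') (hτ₂ : ∀ s, (V s).1 ≤ (U₂ (τ₂ s)).1) (a₂ : (s : κ) → Γ(X.left, (U₂ (τ₂ s)).1))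
  (hVa₂ : ∀ s, (V s).1 = X.left.basicOpen (a₂ s))

-- the nine-clause existential over the two socket blocks is slow to unify at default heartbeats
set_option maxHeartbeats 800000 in
include hi halg halgA hJ h𝔫π h𝔫 hb' hU hb he hε₁ hε₂ hφ hL hψ hb'' hU₂ hb₂ he'' hε''₁ hε''₂ hφ'' hL'' hψ'' hc hVa hVa₂ in
/-- **THE CHANGE-OF-ATLAS INTERTWINERS ON A COMMON REFINEMENT** (the hypothesis block `ψW hψW hψW𝔫 ψ₂W hψ₂W hψ₂W𝔫 F hF hFψ` of
★ `exists_cechMD1_eq_refineC2_sub_refineC2`, produced from the chart data): restricted lifts of both systems on `V` (★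
`exists_algEquiv_refine`) and chart automorphisms `F s` of `A ⊗_k Γ(X, V s)`, `≡ 1 (mod mk_J⁻¹ ker π')`, intertwining them
modulo `J` — the lifts reduce, on the opens of `Y` above `V` (★ `exists_preimage_eq`), to the transition data of the two
restricted chart systems (★ `exists_charts_refine`), and `F̄ s = ε″|⁻¹ ε|` lifts (★ `exists_chartAut_of_two_chart_systems`).
[cite: Hartshorne2010, Thm. 10.2 (proof), p. 81] [cite: Hartshorne2010, Cor. 4.8, pp. 32–33] -/
theorem exists_chartIntertwiners [Smooth X.hom] [IsClosedImmersion i] (hnil : IsNilpotent i.ker) :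
    ∃ (ψV : (s t : κ) → A ⊗[k] Γ(X.left, (V s).1 ⊓ (V t).1) ≃ₐ[A] A ⊗[k] Γ(X.left, (V s).1 ⊓ (V t).1))
      (ψ₂V : (s t : κ) → A ⊗[k] Γ(X.left, (V s).1 ⊓ (V t).1) ≃ₐ[A] A ⊗[k] Γ(X.left, (V s).1 ⊓ (V t).1))
      (F : (s : κ) → A ⊗[k] Γ(X.left, (V s).1) ≃ₐ[A] A ⊗[k] Γ(X.left, (V s).1)),
      (∀ (s t : κ) (Φ : A ⊗[k] Γ(X.left, (U (τ s)).1 ⊓ (U (τ t)).1) →ₐ[A] A ⊗[k] Γ(X.left, (V s).1 ⊓ (V t).1)),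
        (∀ a' x, Φ (a' ⊗ₜ x) = a' ⊗ₜ X.left.presheaf.map (homOfLE (inf_le_inf (hτ s) (hτ t))).op x) →
        ∀ x, ψV s t (Φ x) = Φ (ψ (τ s) (τ t) x)) ∧
      (∀ s t x, ψV s t x - x ∈
        ((RingHom.ker π').comap (Ideal.Quotient.mk J)) • (⊤ : Submodule A (A ⊗[k] Γ(X.left, (V s).1 ⊓ (V t).1)))) ∧
      (∀ (s t : κ) (Φ : A ⊗[k] Γ(X.left, (U₂ (τ₂ s)).1 ⊓ (U₂ (τ₂ t)).1) →ₐ[A] A ⊗[k] Γ(X.left, (V s).1 ⊓ (V t).1)),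
        (∀ a' x, Φ (a' ⊗ₜ x) = a' ⊗ₜ X.left.presheaf.map (homOfLE (inf_le_inf (hτ₂ s) (hτ₂ t))).op x) →
        ∀ x, ψ₂V s t (Φ x) = Φ (ψ'' (τ₂ s) (τ₂ t) x)) ∧
      (∀ s t x, ψ₂V s t x - x ∈
        ((RingHom.ker π').comap (Ideal.Quotient.mk J)) • (⊤ : Submodule A (A ⊗[k] Γ(X.left, (V s).1 ⊓ (V t).1)))) ∧
      (∀ s x, F s x - x ∈
        ((RingHom.ker π').comap (Ideal.Quotient.mk J)) • (⊤ : Submodule A (A ⊗[k] Γ(X.left, (V s).1)))) ∧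
      ∀ (s t : κ)
        (Φs : A ⊗[k] Γ(X.left, (V s).1) →ₐ[A] A ⊗[k] Γ(X.left, (V s).1 ⊓ (V t).1))
        (_ : ∀ a x, Φs (a ⊗ₜ x) = a ⊗ₜ X.left.presheaf.map (homOfLE inf_le_left).op x)
        (Φt : A ⊗[k] Γ(X.left, (V t).1) →ₐ[A] A ⊗[k] Γ(X.left, (V s).1 ⊓ (V t).1))
        (_ : ∀ a x, Φt (a ⊗ₜ x) = a ⊗ₜ X.left.presheaf.map (homOfLE inf_le_right).op x)
        (Fs Ft : A ⊗[k] Γ(X.left, (V s).1 ⊓ (V t).1) ≃ₐ[A] A ⊗[k] Γ(X.left, (V s).1 ⊓ (V t).1)),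
        (∀ x, Fs (Φs x) = Φs (F s x)) → (∀ x, Ft (Φt x) = Φt (F t x)) →
        ∀ c : Γ(X.left, (V s).1 ⊓ (V t).1),
          Ft (ψV s t ((1 : A) ⊗ₜ c)) - ψ₂V s t (Fs ((1 : A) ⊗ₜ c)) ∈
            J • (⊤ : Submodule A (A ⊗[k] Γ(X.left, (V s).1 ⊓ (V t).1))) := by
  -- the restricted lifts on the refinement, for both sides (★ `exists_algEquiv_refine`)
  obtain ⟨ψV, hψV, hψV𝔫⟩ := exists_algEquiv_refine halg U b hb (fun s => (V s).1) τ hτ a hVa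
    ((RingHom.ker π').comap (Ideal.Quotient.mk J)) h𝔫 ψ hψ
  obtain ⟨ψV₂, hψV₂, hψV₂𝔫⟩ := exists_algEquiv_refine halg U₂ b₂ hb₂ (fun s => (V s).1) τ₂ hτ₂ a₂ hVa₂
    ((RingHom.ker π').comap (Ideal.Quotient.mk J)) h𝔫 ψ'' hψ''
  -- the opens of `Y` above the refinement (★ `exists_preimage_eq`)
  have hO := fun s => exists_preimage_eq i hnil (V s).1
  choose O hO _hOaff using hO
  -- both chart systems restrict to the refinement; the restricted lifts reduce to their transition data (★ T2)
  obtain ⟨εV, εV₁, εV₂, hεV, hεV₁, hεV₂, hLV⟩ := exists_charts_refine π' halg halgA i hi hnil h𝔫π U' b' hb' U hU b hb e he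
    ε₁ ε₂ hε₁ hε₂ hφ ψ hL (fun s => (V s).1) c hc τ hτ a hVa O hO ψV hψV
  obtain ⟨εV', εV'₁, εV'₂, hεV', hεV'₁, hεV'₂, hLV'⟩ := exists_charts_refine π' halg halgA i hi hnil h𝔫π U'' b'' hb'' U₂
    hU₂ b₂ hb₂ e'' he'' ε''₁ ε''₂ hε''₁ hε''₂ hφ'' ψ'' hL'' (fun s => (V s).1) c hc τ₂ hτ₂ a₂ hVa₂ O hO ψV₂ hψV₂
  -- two chart systems on one cover: intertwining chart automorphisms (★ T1)
  obtain ⟨F, hF, hFψ⟩ := exists_chartAut_of_two_chart_systems π' halg halgA i hi hJ h𝔫π V c hc O (fun s => (hO s).ge)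
    εV εV' hεV hεV' εV₁ εV₂ εV'₁ εV'₂ hεV₁ hεV₂ hεV'₁ hεV'₂ ψV ψV₂ hLV hLV'
  exact ⟨ψV, ψV₂, F, fun s t Φ hΦ x => hψV s t Φ hΦ x, fun s t x => hψV𝔫 s t x, fun s t Φ hΦ x => hψV₂ s t Φ hΦ x,
    fun s t x => hψV₂𝔫 s t x, hF, hFψ⟩

variable (hJ𝔫 : J * (RingHom.ker π').comap (Ideal.Quotient.mk J) = ⊥) (eJ : ↥(J.restrictScalars k) ≃ₗ[k] k)
  -- obstruction cochains of the two lift systems (★ F2's characterisation)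
  (o : CechMC2 X.hom (tangentSheaf X) (fun j => (U j).1))
  (ho : ∀ (j l m : ι)
    (Φjl : A ⊗[k] Γ(X.left, (U j).1 ⊓ (U l).1) →ₐ[A] A ⊗[k] Γ(X.left, (U j).1 ⊓ (U l).1 ⊓ (U m).1))
    (_ : ∀ a s, Φjl (a ⊗ₜ s) = a ⊗ₜ X.left.presheaf.map (homOfLE inf_le_left).op s)
    (Φlm : A ⊗[k] Γ(X.left, (U l).1 ⊓ (U m).1) →ₐ[A] A ⊗[k] Γ(X.left, (U j).1 ⊓ (U l).1 ⊓ (U m).1))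
    (_ : ∀ a s, Φlm (a ⊗ₜ s) = a ⊗ₜ X.left.presheaf.map
      (homOfLE (le_inf (inf_le_left.trans inf_le_right) inf_le_right)).op s)
    (Φjm : A ⊗[k] Γ(X.left, (U j).1 ⊓ (U m).1) →ₐ[A] A ⊗[k] Γ(X.left, (U j).1 ⊓ (U l).1 ⊓ (U m).1))
    (_ : ∀ a s, Φjm (a ⊗ₜ s) = a ⊗ₜ X.left.presheaf.map
      (homOfLE (le_inf (inf_le_left.trans inf_le_left) inf_le_right)).op s)
    (ρjl ρlm ρjm : A ⊗[k] Γ(X.left, (U j).1 ⊓ (U l).1 ⊓ (U m).1) ≃ₐ[A]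
      A ⊗[k] Γ(X.left, (U j).1 ⊓ (U l).1 ⊓ (U m).1)),
    (∀ x, ρjl (Φjl x) = Φjl (ψ j l x)) → (∀ x, ρlm (Φlm x) = Φlm (ψ l m x)) →
    (∀ x, ρjm (Φjm x) = Φjm (ψ j m x)) →
    ∀ c : Γ(X.left, (U j).1 ⊓ (U l).1 ⊓ (U m).1), (ρlm * ρjl * ρjm⁻¹) ((1 : A) ⊗ₜ c) =
      (1 : A) ⊗ₜ c + ((eJ.symm 1 : ↥(J.restrictScalars k)) : A) ⊗ₜ
        (show Γ(X.left, (U j).1 ⊓ (U l).1 ⊓ (U m).1) from appLE (o j l m) (𝟙 _) (dSection X _ c)))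
  (o'' : CechMC2 X.hom (tangentSheaf X) (fun j => (U₂ j).1))
  (ho'' : ∀ (j l m : ι')
    (Φjl : A ⊗[k] Γ(X.left, (U₂ j).1 ⊓ (U₂ l).1) →ₐ[A] A ⊗[k] Γ(X.left, (U₂ j).1 ⊓ (U₂ l).1 ⊓ (U₂ m).1))
    (_ : ∀ a s, Φjl (a ⊗ₜ s) = a ⊗ₜ X.left.presheaf.map (homOfLE inf_le_left).op s)
    (Φlm : A ⊗[k] Γ(X.left, (U₂ l).1 ⊓ (U₂ m).1) →ₐ[A] A ⊗[k] Γ(X.left, (U₂ j).1 ⊓ (U₂ l).1 ⊓ (U₂ m).1))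
    (_ : ∀ a s, Φlm (a ⊗ₜ s) = a ⊗ₜ X.left.presheaf.map
      (homOfLE (le_inf (inf_le_left.trans inf_le_right) inf_le_right)).op s)
    (Φjm : A ⊗[k] Γ(X.left, (U₂ j).1 ⊓ (U₂ m).1) →ₐ[A] A ⊗[k] Γ(X.left, (U₂ j).1 ⊓ (U₂ l).1 ⊓ (U₂ m).1))
    (_ : ∀ a s, Φjm (a ⊗ₜ s) = a ⊗ₜ X.left.presheaf.map
      (homOfLE (le_inf (inf_le_left.trans inf_le_left) inf_le_right)).op s)
    (ρjl ρlm ρjm : A ⊗[k] Γ(X.left, (U₂ j).1 ⊓ (U₂ l).1 ⊓ (U₂ m).1) ≃ₐ[A]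
      A ⊗[k] Γ(X.left, (U₂ j).1 ⊓ (U₂ l).1 ⊓ (U₂ m).1)),
    (∀ x, ρjl (Φjl x) = Φjl (ψ'' j l x)) → (∀ x, ρlm (Φlm x) = Φlm (ψ'' l m x)) →
    (∀ x, ρjm (Φjm x) = Φjm (ψ'' j m x)) →
    ∀ c : Γ(X.left, (U₂ j).1 ⊓ (U₂ l).1 ⊓ (U₂ m).1), (ρlm * ρjl * ρjm⁻¹) ((1 : A) ⊗ₜ c) =
      (1 : A) ⊗ₜ c + ((eJ.symm 1 : ↥(J.restrictScalars k)) : A) ⊗ₜ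
        (show Γ(X.left, (U₂ j).1 ⊓ (U₂ l).1 ⊓ (U₂ m).1) from appLE (o'' j l m) (𝟙 _) (dSection X _ c)))

include hi halg halgA hJ hJ𝔫 h𝔫π h𝔫 hb' hU hb he hε₁ hε₂ hφ hL hψ hb'' hU₂ hb₂ he'' hε''₁ hε''₂ hφ'' hL'' hψ'' hc hVa hVa₂
  ho ho'' in
/-- **COVER INDEPENDENCE OF THE OBSTRUCTION COCHAIN, from the chart data**: for obstruction cochains `o`, `o″` of the two lift
systems, `ρ_{τ₂} o″ − ρ_τ o = d¹α` on the common refinement (★ `exists_cechMD1_eq_refineC2_sub_refineC2` fed by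
`exists_chartIntertwiners`). [cite: Hartshorne2010, Thm. 10.2 (proof), p. 81] [cite: Hartshorne2010, Cor. 10.3, p. 82]
[cite: GortzWedhorn2023, (21.16) Lemma 21.72 (p. 262)] -/
theorem exists_cechMD1_eq_refineC2_sub_refineC2_of_charts [Smooth X.hom] [IsClosedImmersion i]
    (hnil : IsNilpotent i.ker) :
    ∃ α : CechMC1 X.hom (tangentSheaf X) (fun s => (V s).1),
      cechMRefineC2 X.hom (tangentSheaf X) (fun j => (U₂ j).1) (fun s => (V s).1) τ₂ hτ₂ o'' -
        cechMRefineC2 X.hom (tangentSheaf X) (fun j => (U j).1) (fun s => (V s).1) τ hτ o =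
      cechMD1 X.hom (tangentSheaf X) (fun s => (V s).1) α := by
  obtain ⟨ψV, ψ₂V, F, hψV, hψV𝔫, hψ₂V, hψ₂V𝔫, hF, hFψ⟩ := exists_chartIntertwiners π' halg halgA i hi hJ h𝔫π h𝔫 U' b' hb'
    U hU b hb e he ε₁ ε₂ hε₁ hε₂ hφ ψ hL hψ U'' b'' hb'' U₂ hU₂ b₂ hb₂ e'' he'' ε''₁ ε''₂ hε''₁ hε''₂ hφ'' ψ'' hL'' hψ'' V c hc
    τ hτ a hVa τ₂ hτ₂ a₂ hVa₂ hnil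
  exact exists_cechMD1_eq_refineC2_sub_refineC2 halg J ((RingHom.ker π').comap (Ideal.Quotient.mk J)) hJ hJ𝔫 eJ U b hb
    U₂ b₂ hb₂ V c hc τ hτ a hVa τ₂ hτ₂ a₂ hVa₂ h𝔫 ψ hψ o ho ψ'' hψ'' o'' ho'' ψV hψV hψV𝔫 ψ₂V hψ₂V hψ₂V𝔫 F hF hFψ

include hi halg halgA hJ hJ𝔫 h𝔫π h𝔫 hb' hU hb he hε₁ hε₂ hφ hL hψ hb'' hU₂ hb₂ he'' hε''₁ hε''₂ hφ'' hL'' hψ'' hc hVa hVa₂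
  ho ho'' in
/-- **COVER INDEPENDENCE OF THE OBSTRUCTION CLASS, componentwise, from the chart data**: for every `φ : 𝒯_{X/k} ⟶ N`,
`[ρ_{τ₂}(φ o″)] = [ρ_τ(φ o)]` in `Ȟ²(𝔙, N)` (★ `CechMH2.mk_refineC2_mapC2_eq_of_two_covers` fed by `exists_chartIntertwiners`)
— relation rel₂ of the componentwise criterion ★ `Morphisms/CechModuleH2ScalingVanishing`.
[cite: Hartshorne2010, Thm. 10.2 (proof), p. 81] [cite: GortzWedhorn2023, (21.16) Lemma 21.72 (p. 262)] -/
theorem CechMH2.mk_refineC2_mapC2_eq_of_two_covers_of_charts [Smooth X.hom] [IsClosedImmersion i]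
    (hnil : IsNilpotent i.ker) (hoZ : o ∈ cechMZ2 X.hom (tangentSheaf X) (fun j => (U j).1))
    (ho''Z : o'' ∈ cechMZ2 X.hom (tangentSheaf X) (fun j => (U₂ j).1)) {N : X.left.Modules} (φ : tangentSheaf X ⟶ N) :
    CechMH2.mk X.hom N (fun s => (V s).1)
        ⟨cechMRefineC2 X.hom N (fun j => (U₂ j).1) (fun s => (V s).1) τ₂ hτ₂ (cechMapC2 X.hom φ (fun j => (U₂ j).1) o''),
          refineMC2_mem_cechMZ2 X.hom N (fun j => (U₂ j).1) (fun s => (V s).1) τ₂ hτ₂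
            (mapC2_mem_cechMZ2 X.hom φ (fun j => (U₂ j).1) ho''Z)⟩ =
      CechMH2.mk X.hom N (fun s => (V s).1)
        ⟨cechMRefineC2 X.hom N (fun j => (U j).1) (fun s => (V s).1) τ hτ (cechMapC2 X.hom φ (fun j => (U j).1) o),
          refineMC2_mem_cechMZ2 X.hom N (fun j => (U j).1) (fun s => (V s).1) τ hτ
            (mapC2_mem_cechMZ2 X.hom φ (fun j => (U j).1) hoZ)⟩ := by
  obtain ⟨ψV, ψ₂V, F, hψV, hψV𝔫, hψ₂V, hψ₂V𝔫, hF, hFψ⟩ := exists_chartIntertwiners π' halg halgA i hi hJ h𝔫π h𝔫 U' b' hb'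
    U hU b hb e he ε₁ ε₂ hε₁ hε₂ hφ ψ hL hψ U'' b'' hb'' U₂ hU₂ b₂ hb₂ e'' he'' ε''₁ ε''₂ hε''₁ hε''₂ hφ'' ψ'' hL'' hψ'' V c hc
    τ hτ a hVa τ₂ hτ₂ a₂ hVa₂ hnil
  exact CechMH2.mk_refineC2_mapC2_eq_of_two_covers halg J ((RingHom.ker π').comap (Ideal.Quotient.mk J)) hJ hJ𝔫 eJ U b hb
    U₂ b₂ hb₂ V c hc τ hτ a hVa τ₂ hτ₂ a₂ hVa₂ h𝔫 ψ hψ o ho ψ'' hψ'' o'' ho'' ψV hψV hψV𝔫 ψ₂V hψ₂V hψ₂V𝔫 F hF hFψ hoZ ho''Z φ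

end Literature.AlgebraicGeometry.Deformation

end
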